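import Literature.Geometry.Riemannian.HamiltonPCOPinchingThreeCore
import Literature.Geometry.Riemannian.PositiveCurvatureOperatorBlocks
import Mathlib.Analysis.SpecialFunctions.Pow.Real
import HarnessLib

/-!
# Hamilton 1986, Thm. 7.1, inequality (4): the pointwise inputs (Cors. 7.5, 7.6)
(topic `Geometry/Riemannian`)

Pointwise algebra for the fourth group of inequalities of the pinching set of **Hamilton 1986,
Thm. 7.1** (J. Differential Geom. 24, p. 170), `(b₂ + b₃)^{2+ε} ≤ K a₁c₁`, towards
`Literature.Geometry.Riemannian.hamilton_positiveCurvatureOperator_classification_four`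
(`HamiltonPCOClassification.lean`; see `HamiltonPCOPinchingOne.lean` for (1),
`HamiltonPCOPinchingThreeCore.lean` for the inputs of (3)). Hamilton, pp. 172–173:

* **Cor. 7.5.** "There exists `η > 0` such that on the set defined by the inequality (3) we have
  `b ≤ (1 - η)a`" (if `b ≥ a/2` then `b₂ + b₃ ≥ ⅔b ≥ ⅓a` and (3) gives `a^{2+δ} ≤ k a²(a - b)^δ`);
* **Cor. 7.6.** "There exists `λ > 0` such that on the set defined by inequality (3) we have
  [the thrown-away terms] `≥ λa`" ("Since `ηa ≤ a - b ≤ 3(a₃ - b₁)` we must have either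
  `a₃ - a₁ ≥ ⅙ηa` or `a₁ - b₁ ≥ ⅙ηa`");
* and the conclusion: "`d/dt log (b₂ + b₃) ≤ 2b₁ + a₃ + c₃ ≤ 4a` since in fact `2b₁ ≤ a₃ + c₃ ≤ 2a`.
  Then if `ε` is small enough `d/dt log [a₁c₁/(b₂ + b₃)^{2+ε}] ≥ 0`".

Here `a = tr A = c = tr C`, `b = b₁ + b₂ + b₃ = tr (BT)` at a maximiser `T ∈ O(3)`. In the
tree's variational language (`b₂ + b₃ = Y`, `b₁ = k`, `a₁ = x`, `a₃ = Mᴬ`, …) this file PROVES: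

* `trace_mul_le_two_mul_kyFanMax` — `tr (BT) ≤ 2(b₂ + b₃)` for every orthogonal `T` (replacing
  the printed `b₂ + b₃ ≥ ⅔b`; only the constants change), `three_mul_le_trace_mul_maxTrace` —
  `3b₁ ≤ b`, and `abs_kappa_le_half` — `2b₁ ≤ a₃ + c₃` on `{M ≥ 0}`;
* `cor75` — with `η ≤ ½` and `16 · 8^δ J η^δ ≤ 1`: `ηa ≤ a - b` (scalar form of Cor. 7.5);
* `cor76` — `min(δη/3, η²/36) · a ≤` [the thrown-away terms] (scalar form of Cor. 7.6);
* `pcoFour_ell` — the two logarithmic-derivative bounds for (4): there is `ℓ` with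
  `(2 + ε)Y' ≤ ℓY` and `ℓ · x x_c ≤ X' x_c + x X_C'`, provided `12ε ≤ δη` and `144ε ≤ η²`
  ("if `ε` is small enough").

No definitions, no named facts (D-0026).

## References

* R. S. Hamilton, *Four-manifolds with positive curvature operator*, J. Differential Geom. 24
  (1986) 153–179: §7, Thm. 7.1 (p. 170), Lemma 7.2 (p. 171), Lemma 7.3, (7.4), Cor. 7.5 (p. 172),
  Cor. 7.6 and the proof of (4) (p. 173). [Hamilton1986]
-/

noncomputable section

open Set Real
open scoped Matrix BigOperators

namespace Literature.Geometry.Riemannian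

namespace HamiltonODE

variable {A B C : Matrix (Fin 3) (Fin 3) ℝ}

/-! ### Traces against orthogonal matrices and the Ky Fan maximum -/

/-- `tr M = Σᵢ ᵗeᵢ M eᵢ` over the standard basis. [folklore] -/
theorem trace_eq_sum_single_quad (M : Matrix (Fin 3) (Fin 3) ℝ) :
    M.trace = ∑ i : Fin 3, (Pi.single i 1 : Fin 3 → ℝ) ⬝ᵥ (M *ᵥ Pi.single i 1) := by
  simp [Matrix.trace, Fin.sum_univ_three]

/-- The columns `T eᵢ` of an orthogonal matrix are orthonormal. [folklore] -/
theorem dotProduct_mulVec_single_of_orthogonal {T : Matrix (Fin 3) (Fin 3) ℝ} (hT : Tᵀ * T = 1)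
    (i j : Fin 3) :
    (T *ᵥ (Pi.single i 1 : Fin 3 → ℝ)) ⬝ᵥ (T *ᵥ Pi.single j 1) = if i = j then 1 else 0 := by
  have h := congr_fun (congr_fun hT i) j
  rw [← Matrix.dotProduct_transpose_mulVec, Matrix.mulVec_mulVec, hT, Matrix.one_mulVec]
  simp only [Pi.single_apply, dotProduct, Finset.sum_ite_eq', Finset.mem_univ, if_true,
    mul_ite, mul_one, mul_zero]

/-- **`tr (BT) ≤ 2(b₂ + b₃)` for orthogonal `T`**: `tr (BT) = Σᵢ ᵗeᵢ B (Teᵢ)` with `(eᵢ)`, `(Teᵢ)`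
orthonormal; two of the terms form a Ky Fan sum and the third is at most the Ky Fan maximum as
well (complete it by `± ᵗe₀ B (Te₀)`). [folklore] -/
theorem trace_mul_le_two_mul_kyFanMax {T : Matrix (Fin 3) (Fin 3) ℝ} (hT : Tᵀ * T = 1) {Y : ℝ}
    (hmax : ∀ u₁ u₂ v₁ v₂ : Fin 3 → ℝ, u₁ ⬝ᵥ u₁ = 1 → u₂ ⬝ᵥ u₂ = 1 → u₁ ⬝ᵥ u₂ = 0 →
      v₁ ⬝ᵥ v₁ = 1 → v₂ ⬝ᵥ v₂ = 1 → v₁ ⬝ᵥ v₂ = 0 → u₁ ⬝ᵥ (B *ᵥ v₁) + u₂ ⬝ᵥ (B *ᵥ v₂) ≤ Y) :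
    (B * T).trace ≤ 2 * Y := by
  rw [trace_eq_sum_single_quad, Fin.sum_univ_three]
  simp only [← Matrix.mulVec_mulVec]
  have hf := dotProduct_mulVec_single_of_orthogonal hT
  have n₀ : (Pi.single 0 1 : Fin 3 → ℝ) ⬝ᵥ Pi.single 0 1 = 1 := by simp
  have n₁ : (Pi.single 1 1 : Fin 3 → ℝ) ⬝ᵥ Pi.single 1 1 = 1 := by simp
  have n₂ : (Pi.single 2 1 : Fin 3 → ℝ) ⬝ᵥ Pi.single 2 1 = 1 := by simp
  have o₀₁ : (Pi.single 0 1 : Fin 3 → ℝ) ⬝ᵥ Pi.single 1 1 = 0 := by simp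
  have o₂₀ : (Pi.single 2 1 : Fin 3 → ℝ) ⬝ᵥ Pi.single 0 1 = 0 := by simp
  have m₀ := hf 0 0
  have m₁ := hf 1 1
  have m₂ := hf 2 2
  have p₀₁ := hf 0 1
  have p₂₀ := hf 2 0
  rw [if_pos rfl] at m₀ m₁ m₂
  rw [if_neg (by decide)] at p₀₁ p₂₀
  have h1 := hmax _ _ _ _ n₀ n₁ o₀₁ m₀ m₁ p₀₁
  have h2 := hmax _ _ _ _ n₂ n₀ o₂₀ m₂ m₀ p₂₀
  have m₀' : (-(T *ᵥ (Pi.single 0 1 : Fin 3 → ℝ))) ⬝ᵥ (-(T *ᵥ Pi.single 0 1)) = 1 := by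
    rw [neg_dotProduct, dotProduct_neg, neg_neg]; exact m₀
  have p₂₀' : (T *ᵥ (Pi.single 2 1 : Fin 3 → ℝ)) ⬝ᵥ (-(T *ᵥ Pi.single 0 1)) = 0 := by
    rw [dotProduct_neg, p₂₀, neg_zero]
  have h3 := hmax _ _ _ _ n₂ n₀ o₂₀ m₂ m₀' p₂₀'
  rw [Matrix.mulVec_neg, dotProduct_neg] at h3
  linarith

/-- **`3b₁ ≤ b`**: at a maximiser `T` of `tr (BT)`, `3k ≤ tr (BT)` whenever `k² ≤ |Be|²` for all
unit `e` (each `ᵗeᵢ (BT) eᵢ ≥ k`, `rayleigh_mul_maxTrace_ge`). [folklore] -/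
theorem three_mul_le_trace_mul_maxTrace {T : Matrix (Fin 3) (Fin 3) ℝ}
    (hmax : ∀ T' : Matrix (Fin 3) (Fin 3) ℝ, T'ᵀ * T' = 1 → (B * T').trace ≤ (B * T).trace)
    (hT : Tᵀ * T = 1) {k : ℝ} (hkB : ∀ e : Fin 3 → ℝ, e ⬝ᵥ e = 1 → k ^ 2 ≤ (B *ᵥ e) ⬝ᵥ (B *ᵥ e)) :
    3 * k ≤ (B * T).trace := by
  rw [trace_eq_sum_single_quad, Fin.sum_univ_three]
  have hn : ∀ i : Fin 3, (Pi.single i 1 : Fin 3 → ℝ) ⬝ᵥ Pi.single i 1 = 1 := by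
    intro i; fin_cases i <;> simp
  have h : ∀ i : Fin 3, k ≤ (Pi.single i 1 : Fin 3 → ℝ) ⬝ᵥ ((B * T) *ᵥ Pi.single i 1) := by
    intro i
    have := rayleigh_mul_maxTrace_ge hmax hT hkB (Pi.single i 1)
    rwa [hn i, mul_one] at this
  linarith [h 0, h 1, h 2]

/-- **`2b₁ ≤ a₃ + c₃` on `{M ≥ m}`, `m ≥ 0`** (Hamilton, p. 173: "since in fact `2b₁ ≤ a₃ + c₃`"):
`2|ᵗu B v| ≤ ᵗuAu + ᵗvCv ≤ Mᴬ + Mᶜ` for unit `u, v`. [cite: Hamilton1986, §7, p. 173] -/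
theorem abs_cross_le_half {m MA MC : ℝ} (hm : 0 ≤ m) (h : OperatorGE (A, B, C) m)
    (hMA : ∀ e : Fin 3 → ℝ, e ⬝ᵥ e = 1 → e ⬝ᵥ (A *ᵥ e) ≤ MA)
    (hMC : ∀ e : Fin 3 → ℝ, e ⬝ᵥ e = 1 → e ⬝ᵥ (C *ᵥ e) ≤ MC) {u v : Fin 3 → ℝ} (hu : u ⬝ᵥ u = 1)
    (hv : v ⬝ᵥ v = 1) : 2 * |u ⬝ᵥ (B *ᵥ v)| ≤ MA + MC := by
  have h1 := h.two_mul_abs_cross_le u v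
  simp only at h1
  rw [hu, hv] at h1
  have := hMA u hu
  have := hMC v hv
  nlinarith

/-! ### Cor. 7.5 and Cor. 7.6, scalar forms -/

/-- **Hamilton 1986, Cor. 7.5 (scalar form).** With `a = tr A = tr C > 0`, `b = tr (BT) ≤ a`,
`Y = b₂ + b₃ ≥ 0` with `b ≤ 2Y`, `x = a₁ ≤ a`, `0 ≤ x_c = c₁ ≤ a`, and (3) in the form
`(Y²)^{1+δ/2} ≤ J x x_c (2(a - b))^δ`: if `0 < η ≤ ½` and `16 · 8^δ · J · η^δ ≤ 1` then
`ηa ≤ a - b` ("`b ≤ (1 - η)a`"). [cite: Hamilton1986, §7, Cor. 7.5 (p. 172)] -/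
theorem cor75 {J δ η a b Y x xc : ℝ} (hJ : 0 ≤ J) (hδ : 0 < δ) (hη : 0 < η) (hη2 : η ≤ 1 / 2)
    (hηJ : 16 * 8 ^ δ * J * η ^ δ ≤ 1) (ha : 0 < a) (hxa : x ≤ a) (hxc : 0 ≤ xc) (hxca : xc ≤ a)
    (hab : b ≤ a) (hY : 0 ≤ Y) (hbY : b ≤ 2 * Y)
    (hthree : (Y ^ 2) ^ (1 + δ / 2) ≤ J * x * xc * (2 * (a - b)) ^ δ) :
    η * a ≤ a - b := by
  rcases le_or_gt b (a / 2) with hb | hb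
  · nlinarith
  · have hYa : a / 4 < Y := by linarith
    have hY0 : 0 < Y := by linarith
    have hamb : 0 ≤ a - b := by linarith
    have e1 : (Y ^ 2) ^ (1 + δ / 2) = Y ^ 2 * Y ^ δ := by
      rw [← Real.rpow_two, ← Real.rpow_mul hY0.le, show 2 * (1 + δ / 2) = 2 + δ by ring,
        Real.rpow_add hY0, Real.rpow_two]
    rw [e1] at hthree
    have h2 : (a / 4) ^ 2 < Y ^ 2 := by nlinarith
    have h3 : (a / 4) ^ δ ≤ Y ^ δ := Real.rpow_le_rpow (by positivity) hYa.le hδ.le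
    have h4 : (a / 4) ^ 2 * (a / 4) ^ δ ≤ Y ^ 2 * Y ^ δ :=
      mul_le_mul h2.le h3 (Real.rpow_nonneg (by positivity) _) (sq_nonneg _)
    have h5 : J * x * xc * (2 * (a - b)) ^ δ ≤ J * a * a * (2 ^ δ * (a - b) ^ δ) := by
      rw [Real.mul_rpow (by norm_num) hamb]
      have : J * x * xc ≤ J * a * a := by
        have := mul_le_mul hxa hxca hxc ha.le
        nlinarith
      exact mul_le_mul this le_rfl (by positivity) (by positivity)
    have h6 : (a / 4) ^ 2 * (a / 4) ^ δ ≤ J * a * a * (2 ^ δ * (a - b) ^ δ) := h4.trans (hthree.trans h5)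
    rw [div_rpow ha.le (by norm_num), show (a / 4) ^ 2 = a * a / 16 by ring] at h6
    have h4δ : (0 : ℝ) < 4 ^ δ := Real.rpow_pos_of_pos (by norm_num) δ
    have h8 : (8 : ℝ) ^ δ = 2 ^ δ * 4 ^ δ := by
      rw [← Real.mul_rpow (by norm_num) (by norm_num)]; norm_num
    have h6' : a ^ δ / 4 ^ δ ≤ 16 * (J * (2 ^ δ * (a - b) ^ δ)) := by
      rw [show J * a * a * (2 ^ δ * (a - b) ^ δ) = a * a / 16 * (16 * (J * (2 ^ δ * (a - b) ^ δ))) by ring]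
        at h6
      exact le_of_mul_le_mul_left h6 (by positivity : 0 < a * a / 16)
    have h7 : a ^ δ ≤ 16 * 8 ^ δ * J * (a - b) ^ δ := by
      have := (div_le_iff₀ h4δ).1 h6'
      calc a ^ δ ≤ 16 * (J * (2 ^ δ * (a - b) ^ δ)) * 4 ^ δ := this
        _ = 16 * 8 ^ δ * J * (a - b) ^ δ := by rw [h8]; ring
    have h10 : (η * a) ^ δ ≤ (a - b) ^ δ := by
      rw [Real.mul_rpow hη.le ha.le]
      calc η ^ δ * a ^ δ ≤ η ^ δ * (16 * 8 ^ δ * J * (a - b) ^ δ) :=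
            mul_le_mul_of_nonneg_left h7 (Real.rpow_nonneg hη.le _)
        _ = (16 * 8 ^ δ * J * η ^ δ) * (a - b) ^ δ := by ring
        _ ≤ 1 * (a - b) ^ δ := mul_le_mul_of_nonneg_right hηJ (Real.rpow_nonneg hamb _)
        _ = (a - b) ^ δ := one_mul _
    exact (Real.rpow_le_rpow_iff (by positivity) hamb hδ).1 h10

/-- **Hamilton 1986, Cor. 7.6 (scalar form)**, together with (7.4): with `a = tr A`,
`a₂ = tr A - a₁ - a₃`, `k = b₁`, `b ≥ 3k`, the bound `ηa ≤ a - b` of Cor. 7.5 and the conclusion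
of Lemma 7.3 for the block `A`, the thrown-away terms of Lemma 7.2 (both blocks) dominate
`min(δη/3, η²/36) · a` (either `a₃ - a₁ ≥ ηa/6`, and Lemma 7.3 applies, or `a₁ - b₁ ≥ ηa/6`, and
`(a₁ - b₁)²/a₁ ≥ η²a/36`). [cite: Hamilton1986, §7, Cor. 7.6 (p. 173)] -/
theorem cor76 {δ η a b x xc MA MC k μ Y tA tC : ℝ} (hδ : 0 < δ) (hη : 0 < η) (ha : 0 < a)
    (hx : 0 < x) (hxc : 0 < xc) (hμY : 0 ≤ μ / Y)
    (hxa : x ≤ tA - x - MA) (haM : tA - x - MA ≤ MA) (hxca : xc ≤ tC - xc - MC) (hcM : tC - xc - MC ≤ MC)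
    (htA : tA = a) (hb3k : 3 * k ≤ b) (hcor : η * a ≤ a - b)
    (h73A : 2 * δ * (MA - x) ≤ (x - k) ^ 2 / x + 2 * MA * (tA - x - MA - x) / x + 2 * (μ / Y) * (MA - (tA - x - MA))) :
    min (δ * η / 3) (η ^ 2 / 36) * a ≤
      ((x - k) ^ 2 / x + 2 * MA * (tA - x - MA - x) / x + 2 * (μ / Y) * (MA - (tA - x - MA))) +
        ((xc - k) ^ 2 / xc + 2 * MC * (tC - xc - MC - xc) / xc + 2 * (μ / Y) * (MC - (tC - xc - MC))) := by
  have t1 : 0 ≤ (x - k) ^ 2 / x := div_nonneg (sq_nonneg _) hx.le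
  have t1c : 0 ≤ (xc - k) ^ 2 / xc := div_nonneg (sq_nonneg _) hxc.le
  have hMA0 : 0 ≤ MA := by linarith
  have hMC0 : 0 ≤ MC := by linarith
  have t2 : 0 ≤ 2 * MA * (tA - x - MA - x) / x := div_nonneg (by nlinarith) hx.le
  have t2c : 0 ≤ 2 * MC * (tC - xc - MC - xc) / xc := div_nonneg (by nlinarith) hxc.le
  have t3 : 0 ≤ 2 * (μ / Y) * (MA - (tA - x - MA)) := by nlinarith
  have t3c : 0 ≤ 2 * (μ / Y) * (MC - (tC - xc - MC)) := by nlinarith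
  have hab3 : a - b ≤ 3 * ((MA - x) + (x - k)) := by
    have : tA ≤ 3 * MA := by linarith
    linarith
  have hmin1 : min (δ * η / 3) (η ^ 2 / 36) ≤ δ * η / 3 := min_le_left _ _
  have hmin2 : min (δ * η / 3) (η ^ 2 / 36) ≤ η ^ 2 / 36 := min_le_right _ _
  rcases le_or_gt (η * a / 6) (MA - x) with hcase | hcase
  · have h1 : δ * η / 3 * a ≤ 2 * δ * (MA - x) := by nlinarith
    have h2 : min (δ * η / 3) (η ^ 2 / 36) * a ≤ δ * η / 3 * a := mul_le_mul_of_nonneg_right hmin1 ha.le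
    nlinarith
  · have hxk : η * a / 6 ≤ x - k := by linarith
    have hxA : x ≤ a := by rw [← htA]; linarith
    have h1 : (η * a / 6) ^ 2 ≤ (x - k) ^ 2 := pow_le_pow_left₀ (by positivity) hxk 2
    have h2 : η ^ 2 / 36 * a ≤ (x - k) ^ 2 / x := by
      rw [le_div_iff₀ hx]
      calc η ^ 2 / 36 * a * x ≤ η ^ 2 / 36 * a * a := by
            exact mul_le_mul_of_nonneg_left hxA (by positivity)
        _ = (η * a / 6) ^ 2 := by ring
        _ ≤ (x - k) ^ 2 := h1
    have h3 : min (δ * η / 3) (η ^ 2 / 36) * a ≤ η ^ 2 / 36 * a := mul_le_mul_of_nonneg_right hmin2 ha.le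
    linarith

/-- **The two logarithmic-derivative bounds for (4), scalar form** (Hamilton 1986, p. 173:
`d/dt log [a₁c₁/(b₂ + b₃)²] ≥ λa`, `d/dt log (b₂ + b₃) ≤ 2b₁ + a₃ + c₃ ≤ 4a`, "Then if `ε` is
small enough `d/dt log [a₁c₁/(b₂ + b₃)^{2+ε}] ≥ 0`"): from the pointwise data of Lemmas 6.1, 7.3
and Cors. 7.5–7.6, with `0 < η ≤ ½`, `16 · 8^δ J η^δ ≤ 1`, `12ε ≤ δη`, `144ε ≤ η²`, there is `ℓ`
with `(2 + ε)Y' ≤ ℓY` and `ℓ · x x_c ≤ X' x_c + x X_C'`. [cite: Hamilton1986, §7, Cors. 7.5–7.6 and p. 173] -/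
theorem pcoFour_ell {x xc MA MC tA tC k μ Y Y' X' XC' Nw Nz b G H J δ η ε : ℝ}
    (hx : 0 < x) (hxc : 0 < xc) (hY : 0 < Y) (hδ : 0 < δ) (hδ1 : δ ≤ 1)
    (hδH : 8 * H * δ ≤ 1) (hδGH : 4 * G * H * δ ^ 2 ≤ 1) (hJ : 0 ≤ J)
    (hη : 0 < η) (hη2 : η ≤ 1 / 2) (hηJ : 16 * 8 ^ δ * J * η ^ δ ≤ 1)
    (hε : 0 ≤ ε) (hε1 : 12 * ε ≤ δ * η) (hε2 : 144 * ε ≤ η ^ 2)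
    (hxa : x ≤ tA - x - MA) (haM : tA - x - MA ≤ MA) (hMA : MA ≤ H * x)
    (hxca : xc ≤ tC - xc - MC) (hcM : tC - xc - MC ≤ MC) (hMC : MC ≤ H * xc)
    (hk : 0 ≤ k) (hkμ : k ≤ μ) (hY2A : Y ^ 2 ≤ G * H * x ^ 2) (hY2C : Y ^ 2 ≤ G * H * xc ^ 2)
    (hNw : k ^ 2 ≤ Nw) (hNz : k ^ 2 ≤ Nz)
    (hX' : x ^ 2 + Nw + 2 * (MA * (tA - x - MA)) ≤ X')
    (hXC' : xc ^ 2 + Nz + 2 * (MC * (tC - xc - MC)) ≤ XC')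
    (hup : Y' ≤ (MA + MC + 2 * k) * Y - μ * ((2 * MA - (tA - x)) + (2 * MC - (tC - xc))))
    (htr : tC = tA) (hkhalf : 2 * k ≤ MA + MC) (hb3k : 3 * k ≤ b) (hbY : b ≤ 2 * Y)
    (hW : 0 < tA - 2 * b + tC)
    (hthree : (Y ^ 2) ^ (1 + δ / 2) ≤ J * x * xc * (tA - 2 * b + tC) ^ δ) :
    ∃ ℓ : ℝ, (2 + ε) * Y' ≤ ℓ * Y ∧ ℓ * (x * xc) ≤ X' * xc + x * XC' := by
  have hμ0 : 0 ≤ μ := hk.trans hkμ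
  have hxM : x ≤ MA := hxa.trans haM
  have hxcM : xc ≤ MC := hxca.trans hcM
  have ha : 0 < tA := by linarith
  -- Cor. 7.5
  have hab : b ≤ tA := by linarith
  have hxA : x ≤ tA := by linarith
  have hxcA : xc ≤ tA := by linarith
  have hthree' : (Y ^ 2) ^ (1 + δ / 2) ≤ J * x * xc * (2 * (tA - b)) ^ δ := by
    rw [show 2 * (tA - b) = tA - 2 * b + tC by rw [htr]; ring]; exact hthree
  have hcor := cor75 hJ hδ hη hη2 hηJ ha hxA hxc.le hxcA hab hY.le hbY hthree'
  -- Lemma 7.3 and Cor. 7.6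
  have h73A := lemma73 hx hxa haM hMA hk hkμ hY hY2A hδ hδ1 hδH hδGH
  have h73C := lemma73 hxc hxca hcM hMC hk hkμ hY hY2C hδ hδ1 hδH hδGH
  have h76 := cor76 (b := b) hδ hη ha hx hxc (div_nonneg hμ0 hY.le) hxa haM hxca hcM rfl hb3k hcor
    (by simpa only [sub_sub] using h73A)
  -- `λ a ≥ 4εa ≥ ε(MA + MC + 2k)`
  have hMAa : MA ≤ tA := by linarith
  have hMCa : MC ≤ tA := by linarith
  have hlam : 4 * ε ≤ min (δ * η / 3) (η ^ 2 / 36) := le_min (by linarith) (by linarith)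
  have hεS : ε * (MA + MC + 2 * k) ≤ min (δ * η / 3) (η ^ 2 / 36) * tA := by
    calc ε * (MA + MC + 2 * k) ≤ ε * (4 * tA) := mul_le_mul_of_nonneg_left (by linarith) hε
      _ = 4 * ε * tA := by ring
      _ ≤ min (δ * η / 3) (η ^ 2 / 36) * tA := mul_le_mul_of_nonneg_right hlam ha.le
  refine ⟨(x ^ 2 + k ^ 2 + 2 * MA * (tA - x - MA)) / x + (xc ^ 2 + k ^ 2 + 2 * MC * (tC - xc - MC)) / xc, ?_, ?_⟩
  · -- `(2 + ε) Y' ≤ ℓ Y`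
    have eA : (x ^ 2 + k ^ 2 + 2 * MA * (tA - x - MA)) / x =
        2 * k + 2 * MA + ((x - k) ^ 2 / x + 2 * MA * (tA - x - MA - x) / x) := by
      field_simp
      ring
    have eC : (xc ^ 2 + k ^ 2 + 2 * MC * (tC - xc - MC)) / xc =
        2 * k + 2 * MC + ((xc - k) ^ 2 / xc + 2 * MC * (tC - xc - MC - xc) / xc) := by
      field_simp
      ring
    rw [eA, eC]
    have t : μ / Y * Y = μ := div_mul_cancel₀ μ hY.ne'
    have e : (2 + ε) * ((MA + MC + 2 * k) * Y - μ * ((2 * MA - (tA - x)) + (2 * MC - (tC - xc)))) =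
        ((2 + ε) * (MA + MC + 2 * k) -
          (2 + ε) * (μ / Y) * ((MA - (tA - x - MA)) + (MC - (tC - xc - MC)))) * Y := by
      rw [sub_mul, show (2 + ε) * (μ / Y) * ((MA - (tA - x - MA)) + (MC - (tC - xc - MC))) * Y =
        (2 + ε) * ((MA - (tA - x - MA)) + (MC - (tC - xc - MC))) * (μ / Y * Y) by ring, t]
      ring
    have a1 := mul_le_mul_of_nonneg_left hup (show (0 : ℝ) ≤ 2 + ε by linarith)
    rw [e] at a1
    have hg0 : 0 ≤ (μ / Y) * ((MA - (tA - x - MA)) + (MC - (tC - xc - MC))) := by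
      have : 0 ≤ (MA - (tA - x - MA)) + (MC - (tC - xc - MC)) := by linarith
      exact mul_nonneg (div_nonneg hμ0 hY.le) this
    have h5 : (2 + ε) * (MA + MC + 2 * k) -
        (2 + ε) * (μ / Y) * ((MA - (tA - x - MA)) + (MC - (tC - xc - MC))) ≤
        2 * k + 2 * MA + ((x - k) ^ 2 / x + 2 * MA * (tA - x - MA - x) / x) +
          (2 * k + 2 * MC + ((xc - k) ^ 2 / xc + 2 * MC * (tC - xc - MC - xc) / xc)) := by
      linarith [h76, hεS, mul_nonneg hε hg0]
    have a2 := mul_le_mul_of_nonneg_right h5 hY.le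
    linarith
  · -- `ℓ x x_c ≤ X' x_c + x X_C'`
    have t1 : (x ^ 2 + k ^ 2 + 2 * MA * (tA - x - MA)) / x * (x * xc) =
        (x ^ 2 + k ^ 2 + 2 * MA * (tA - x - MA)) * xc := by
      rw [← mul_assoc, div_mul_cancel₀ _ hx.ne']
    have t2 : (xc ^ 2 + k ^ 2 + 2 * MC * (tC - xc - MC)) / xc * (x * xc) =
        (xc ^ 2 + k ^ 2 + 2 * MC * (tC - xc - MC)) * x := by
      rw [mul_comm x xc, ← mul_assoc, div_mul_cancel₀ _ hxc.ne']
    rw [add_mul, t1, t2]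
    have a1 := mul_le_mul_of_nonneg_right hX' hxc.le
    have a2 := mul_le_mul_of_nonneg_right hXC' hx.le
    have a4 := mul_le_mul_of_nonneg_right hNw hxc.le
    have a5 := mul_le_mul_of_nonneg_right hNz hx.le
    linarith [a1, a2, a4, a5]

end HamiltonODE

end Literature.Geometry.Riemannian

end
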